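import Literature.CategoryTheory.Preadditive.KrullSchmidtSemiperfect
import Mathlib.CategoryTheory.Preadditive.AdditiveFunctor
import Mathlib.CategoryTheory.Limits.Preserves.Shapes.Biproducts
import HarnessLib

/-!
# Full additive functors with nil kernel: conservativity, indecomposable objects, transport of Krull–Schmidt decompositions
# (André–Kahn, *Nilpotence, radicaux et structures monoïdales*, Prop. 1.4.4, Lemme 1.4.7, §2.3; Krause Cor. 4.4)

Family `hodge`, lane `lit-hodgefound` (foundations library; seat `lit-hodgefound-p39`, generation 37, row g37-#3); topic
`CategoryTheory/Preadditive`, namespace `Literature.CategoryTheory.KrullSchmidt` — sequel of g37-#1 `SemiperfectRings` and g37-#2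
`KrullSchmidtSemiperfect`.  The MECHANISM by which nilpotence theorems yield Krull–Schmidt and conservativity for motives, stated for an
abstract functor: an ADDITIVE functor `F : C ⥤ D` between preadditive categories which is FULL and whose kernel on endomorphisms is NIL
(`F f = 0 ⟹ f` nilpotent, `f : X ⟶ X`) — the shape of `h : CHM(k)_F → NUM(k)_F` on finite-dimensional motives (Kimura–O'Sullivan
nilpotence), or of the projection `𝒜 → 𝒜∕ℐ` onto the quotient by an ideal `ℐ ⊆ rad 𝒜` in André–Kahn.

Sources, verbatim.  André–Kahn [AndreKahn2002Nilpotence]: **Proposition 1.4.4.** «a) Le radical est le plus grand idéal `rad(𝒜)` tel que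
`rad(𝒜)(A,A)` soit contenu (coïncide) avec le radical de Jacobson de `𝒜(A,A)` pour tout objet `A`.  b) C'est aussi le plus grand idéal de `𝒜`
tel que le foncteur quotient `𝒜 → 𝒜∕rad(𝒜)` soit conservatif, i.e. reflète les isomorphismes. Ce foncteur reflète aussi rétractions et
corétractions»; **Définition 1.4.6.** «`T` est dit radiciel si `T(rad(𝒜)) ⊂ rad(ℬ)`»; **Lemme 1.4.7.** «Si `T` est plein, il est radiciel.
D'autre part, si `T` est conservatif, on a `T⁻¹(rad(ℬ)) ⊂ rad(𝒜)`» (proof: «soit `f ∈ 𝒜(A,B)` tel que `T(f) ∈ rad(ℬ)(T(A),T(B))`. Alors pour tout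
`g ∈ 𝒜(B,A)`, `1_{T(A)} − T(g) ∘ T(f)` est inversible. Donc `1_A − g ∘ f` est inversible puisque `T` est conservatif»); **Définition 2.3.1.**
(catégorie semi-primaire: «pour tout objet `A ∈ 𝒜`, le radical `rad(𝒜(A,A))` est nilpotent; `𝒜∕rad(𝒜)` est semi-simple»), **Remarque 2.3.2 a)**
«une catégorie `K`-linéaire est semi-primaire si et seulement si tous ses anneaux d'endomorphismes sont semi-primaires»; **Lemme 2.3.3.** «Soit `N`
un nil-idéal d'un anneau `A`. Alors tout idempotent de `A∕N` se relève en un idempotent de `A`»; **Proposition 2.3.4.** «d) Si `𝒜` est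
`K`-linéaire et si `𝒜(A,A)` est un anneau artinien pour tout `A ∈ 𝒜`, alors `𝒜` est semi-primaire. … f) Si `𝒜` est semi-primaire et
pseudo-abélienne, et `T : 𝒜 → ℬ` est un `K`-foncteur radiciel qui n'envoie aucun objet non nul de `𝒜` sur l'objet nul de `ℬ`, alors `T` est
conservatif.»  Krause [Krause2015KS, Cor. 4.4]: «An additive category is a Krull-Schmidt category if and only if it has split idempotents
and the endomorphism ring of every object is semi-perfect.»

## What is formalised (`F : C ⥤ D` additive between preadditive categories; «nil kernel at `X`» = `∀ f : X ⟶ X, F f = 0 → f` nilpotent)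

* §1 the nil-kernel hypothesis: it passes to RETRACTS of `X` (`nilKernel_of_split`), to biproduct summands and isomorphic objects;
  `F` REFLECTS ZERO OBJECTS at such `X` (`isZero_of_isZero_obj`).
* §2 **CONSERVATIVITY (AK 1.4.4 b), 2.3.4 f) pattern): a FULL additive functor with nil kernel at `X` and `Y` reflects isomorphisms
  `X ⟶ Y`** (`isIso_of_isIso_map`: with `F g = (F f)⁻¹`, `fg` and `gf` lie in `1 + nil ⊆` units); objects with `F X ≅ F Y` are isomorphic
  (`nonempty_iso_of_iso_obj`, `nonempty_iso_iff`); `F` reflects split epis ∕ split monos defined by `F`-inverses up to units.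
* §3 endomorphism rings: `F.mapEnd` is onto with nil kernel, so (g37-#1) **`End X` is semiperfect when `End (F X)` is semiperfect ∕ left
  artinian ∕ finite-dimensional** (`isSemiperfectRing_end_of_full_of_nilKernel…`), `End X` local ⟺ `End (F X)` local.
* §4 **INDECOMPOSABILITY IS REFLECTED (split idempotents in `D`) AND PRESERVED (split idempotents in `C`, `F` full)** — idempotents lift along
  nil kernels (AK Lemme 2.3.3 = Mathlib) and a nilpotent idempotent is `0` (`indecomposable_of_indecomposable_obj`,
  `indecomposable_obj_of_indecomposable`, `indecomposable_iff_indecomposable_obj`).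
* §5 **TRANSPORT OF KRULL–REMAK–SCHMIDT DECOMPOSITIONS**: if `End (F X)` is left artinian (e.g. `D` `Hom`-finite) then `X` has a KRS
  decomposition in `C` (g37-#2), and `F` maps any decomposition of `X` into indecomposables to a decomposition of `F X` into indecomposables
  with local endomorphism rings (`exists_iso_biproduct_indecomposable_and_obj`, `krullRemakSchmidt_of_full_of_nilKernel`).

Theorems only, 0 `sorry`, no definition, no named fact (net debt 0, D-0026), no instance, no notation.  NOT here: the global statements
of AK §2.3 for the radical FUNCTOR `𝒜 → 𝒜∕rad 𝒜` (Mathlib's `CategoryTheory.Quotient` carries its preadditive structure as a `def`), and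
the nilpotence theorems themselves (Kimura, O'Sullivan) — inputs to be supplied by the motivic files.

## Mathlib / Literature search

Mathlib: `Functor.Full` (`Functor.map_surjective`), `Functor.Additive` (`map_add`, `map_sub`, preserves finite biproducts:
`Functor.mapBiproduct`), `Functor.mapEnd` (monoid hom; made a ring hom here with `RingHom.mk'`), `isUnit_iff_isIso`, `IsNilpotent.isUnit_add_one`,
`IsIdempotentElem.eq_zero_of_isNilpotent`, `exists_isIdempotentElem_eq_of_ker_isNilpotent`, `Functor.map_isZero`, `isIso_of_epi_of_isSplitMono`;
Mathlib has `Functor.ReflectsIsomorphisms` but no criterion of this kind (`rg "nilpotent" Mathlib/CategoryTheory` → derived-category material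
only).  Literature: g36-#13 `indecomposable_of_forall_idempotent`, `idempotent_eq_zero_or_id_of_indecomposable`, `nontrivial_end_of_not_isZero`;
g37-#1 `isSemiperfectRing_of_surjective_of_nil_ker`, `isLocalRing_of_ker_le_jacobson`, `isLocalRing_of_surjective`,
`ker_le_jacobson_of_forall_isNilpotent`; g37-#2 `krullRemakSchmidt_of_isSemiperfectRing`, `isLocalRing_end_of_iso_biproduct_of_indecomposable`.

## References

* Y. André, B. Kahn (appendix by P. O'Sullivan), *Nilpotence, radicaux et structures monoïdales*, Rend. Sem. Mat. Univ. Padova 108 (2002),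
  107–291, arXiv:math/0203273: Prop. 1.4.4, Déf. 1.4.6, Lemme 1.4.7, Déf. 2.3.1, Rem. 2.3.2, Lemme 2.3.3, Prop. 2.3.4. [AndreKahn2002Nilpotence]
* H. Krause, *Krull–Schmidt categories and projective covers*, Expo. Math. 33 (2015), 535–549: Cor. 4.4, Thm. 4.2. [Krause2015KS]
* T. Y. Lam, *A First Course in Noncommutative Rings*, 2nd ed. (2001): §21 Thm. (21.28), Cor. (21.29); §23. [Lam2001FirstCourse]
-/

open CategoryTheory CategoryTheory.Limits

namespace Literature.CategoryTheory.KrullSchmidt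

open Literature.RingTheory.Idempotents (IsSemiperfectRing)

universe v v' u u'

variable {C : Type u} [Category.{v} C] [Preadditive C] {D : Type u'} [Category.{v'} D] [Preadditive D]
variable (F : C ⥤ D) [F.Additive]

/-! ## §1 The nil-kernel hypothesis: retracts, summands; reflection of zero objects -/

section NilKernel

variable {F}

omit [F.Additive] in
/-- **The nil-kernel hypothesis passes to retracts**: if `ι ≫ π = 𝟙 Y` (`Y` a retract of `X`) and every endomorphism of `X` killed by `F`
is nilpotent, the same holds for `Y` — for `F f = 0`, `F(π f ι) = 0`, so `(π f ι)ⁿ = π fⁿ ι = 0` and `fⁿ = ι (π fⁿ ι) π = 0`.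
[cite: AndreKahn2002Nilpotence, Prop. 2.3.4 c) (Morita invariance of semi-primarity, proof)] -/
theorem nilKernel_of_split [F.PreservesZeroMorphisms] {X Y : C} (ι : Y ⟶ X) (π : X ⟶ Y) (hιπ : ι ≫ π = 𝟙 Y)
    (hX : ∀ f : X ⟶ X, F.map f = 0 → IsNilpotent (End.of f)) (f : Y ⟶ Y) (hf : F.map f = 0) : IsNilpotent (End.of f) := by
  obtain ⟨n, hn⟩ := hX (π ≫ f ≫ ι) (by rw [F.map_comp, F.map_comp, hf, zero_comp, comp_zero])
  -- `(π f ι)^m = π f^m ι`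
  have hpow : ∀ m : ℕ, (End.of (π ≫ f ≫ ι)) ^ (m + 1) = End.of (π ≫ End.asHom (End.of f ^ (m + 1)) ≫ ι) := by
    intro m
    induction m with
    | zero => simp only [zero_add, pow_one]
    | succ m ih =>
      rw [pow_succ, ih, pow_succ]
      show (π ≫ f ≫ ι) ≫ (π ≫ End.asHom (End.of f ^ (m + 1)) ≫ ι) = π ≫ (f ≫ End.asHom (End.of f ^ (m + 1))) ≫ ι
      simp only [Category.assoc, reassoc_of% hιπ]
  refine ⟨n + 1, ?_⟩
  have h0 : (End.of (π ≫ f ≫ ι)) ^ (n + 1) = 0 := by rw [pow_succ, hn, zero_mul]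
  rw [hpow] at h0
  -- `f^(n+1) = ι ≫ (π f^(n+1) ι) ≫ π = 0`
  have : End.asHom (End.of f ^ (n + 1)) = ι ≫ (π ≫ End.asHom (End.of f ^ (n + 1)) ≫ ι) ≫ π := by
    simp only [Category.assoc, hιπ, Category.comp_id, reassoc_of% hιπ]
  change End.asHom (End.of f ^ (n + 1)) = 0
  rw [this]
  change ι ≫ End.asHom (End.of (π ≫ End.asHom (End.of f ^ (n + 1)) ≫ ι)) ≫ π = 0
  rw [h0]
  change ι ≫ (0 : X ⟶ X) ≫ π = 0
  rw [zero_comp, comp_zero]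

omit [F.Additive] in
/-- Along an isomorphism `X ≅ Y`, the nil-kernel hypothesis transfers. [cite: AndreKahn2002Nilpotence, Prop. 2.3.4 c)] -/
theorem nilKernel_of_iso [F.PreservesZeroMorphisms] {X Y : C} (i : X ≅ Y)
    (hX : ∀ f : X ⟶ X, F.map f = 0 → IsNilpotent (End.of f)) (f : Y ⟶ Y) (hf : F.map f = 0) : IsNilpotent (End.of f) :=
  nilKernel_of_split i.inv i.hom i.inv_hom_id hX f hf

omit [F.Additive] in
/-- Biproduct summands inherit the nil-kernel hypothesis. [cite: AndreKahn2002Nilpotence, Prop. 2.3.4 c)] -/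
theorem nilKernel_of_iso_biproduct [F.PreservesZeroMorphisms] [HasFiniteBiproducts C] {X : C} {ι : Type} [Fintype ι] {Xs : ι → C}
    (i : X ≅ ⨁ Xs) (hX : ∀ f : X ⟶ X, F.map f = 0 → IsNilpotent (End.of f)) (j : ι) (f : Xs j ⟶ Xs j) (hf : F.map f = 0) :
    IsNilpotent (End.of f) :=
  nilKernel_of_split (biproduct.ι Xs j ≫ i.inv) (i.hom ≫ biproduct.π Xs j) (biproductIncl_comp_proj i j) hX f hf

omit [F.Additive] in
/-- **`F` reflects zero objects at `X`** when its kernel at `X` is nil: `F X ≅ 0` gives `F(1_X) = 0`, so `1_X` is nilpotent, `1_X = 0`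
(AK 2.3.4 f): a radiciel functor on a semi-primary category «qui n'envoie aucun objet non nul sur l'objet nul»).
[cite: AndreKahn2002Nilpotence, Prop. 2.3.4 f)] -/
theorem isZero_of_isZero_obj [F.PreservesZeroMorphisms] {X : C} (hX : ∀ f : X ⟶ X, F.map f = 0 → IsNilpotent (End.of f))
    (h : IsZero (F.obj X)) : IsZero X := by
  obtain ⟨n, hn⟩ := hX (𝟙 X) (h.eq_of_src _ _)
  have h1 : (End.of (𝟙 X)) ^ n = 1 := one_pow n
  rw [hn] at h1
  exact (IsZero.iff_id_eq_zero X).2 h1.symm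

omit [F.Additive] in
/-- `X ≅ 0 ⟺ F X ≅ 0` under the nil-kernel hypothesis at `X`. [cite: AndreKahn2002Nilpotence, Prop. 2.3.4 f)] -/
theorem isZero_iff_isZero_obj [F.PreservesZeroMorphisms] {X : C} (hX : ∀ f : X ⟶ X, F.map f = 0 → IsNilpotent (End.of f)) :
    IsZero X ↔ IsZero (F.obj X) :=
  ⟨fun h => F.map_isZero h, isZero_of_isZero_obj hX⟩

end NilKernel

/-! ## §2 Conservativity (André–Kahn 1.4.4 b), 1.4.7, 2.3.4 f)) -/

section Conservative

variable {F}

/-- **An endomorphism sent to an isomorphism is an isomorphism** (`F` full, nil kernel at `X`): with `F g = (F f)⁻¹`, `F(fg − 1) = 0`, so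
`fg ∈ 1 + nil(End X) ⊆ U(End X)`, and likewise `gf`. [cite: AndreKahn2002Nilpotence, Prop. 1.4.4 b), Lemme 1.4.7 (proof)] -/
theorem isUnit_end_of_isUnit_map [F.Full] {X : C} (hX : ∀ f : X ⟶ X, F.map f = 0 → IsNilpotent (End.of f)) (f : End X)
    (hf : IsUnit (F.mapEnd X f)) : IsUnit f := by
  obtain ⟨u, hu⟩ := hf
  obtain ⟨g, hg⟩ := F.map_surjective (↑u⁻¹ : End (F.obj X))
  -- `hu : ↑u = F.map f`, `hg : F.map g = ↑u⁻¹`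
  -- in `End (F X)` (`x * y = y ≫ x`): `u⁻¹u = 1` reads `F f ≫ u⁻¹ = 𝟙`, `uu⁻¹ = 1` reads `u⁻¹ ≫ F f = 𝟙`
  have hfu : F.map (End.asHom f) ≫ (↑u⁻¹ : End (F.obj X)) = 𝟙 (F.obj X) := by
    have h := u.inv_mul; rw [hu] at h; exact h
  have huf : (↑u⁻¹ : End (F.obj X)) ≫ F.map (End.asHom f) = 𝟙 (F.obj X) := by
    have h := u.mul_inv; rw [hu] at h; exact h
  have h1 : IsNilpotent (End.of g * f - 1) := by
    refine hX _ ?_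
    show F.map (End.asHom f ≫ g - 𝟙 X) = 0
    rw [F.map_sub, F.map_comp, F.map_id, hg, hfu, sub_self]
  have h2 : IsNilpotent (f * End.of g - 1) := by
    refine hX _ ?_
    show F.map (g ≫ End.asHom f - 𝟙 X) = 0
    rw [F.map_sub, F.map_comp, F.map_id, hg, huf, sub_self]
  have hgf : IsUnit (End.of g * f) := by simpa using h1.isUnit_add_one
  have hfg : IsUnit (f * End.of g) := by simpa using h2.isUnit_add_one
  obtain ⟨a, ha⟩ := hfg.exists_right_inv
  obtain ⟨b, hb⟩ := hgf.exists_left_inv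
  exact isUnit_iff_exists_and_exists.mpr ⟨⟨End.of g * a, by rw [← mul_assoc, ha]⟩, ⟨b * End.of g, by rw [mul_assoc, hb]⟩⟩

/-- `F.mapEnd X` is a local homomorphism: it reflects units of `End X`. [cite: AndreKahn2002Nilpotence, Prop. 1.4.4 b), Lemme 1.4.7] -/
theorem isUnit_end_iff [F.Full] {X : C} (hX : ∀ f : X ⟶ X, F.map f = 0 → IsNilpotent (End.of f)) (f : End X) :
    IsUnit f ↔ IsUnit (F.mapEnd X f) :=
  ⟨fun h => h.map _, isUnit_end_of_isUnit_map hX f⟩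

/-- Endomorphisms: `F f` an isomorphism ⟹ `f` an isomorphism. [cite: AndreKahn2002Nilpotence, Prop. 1.4.4 b)] -/
theorem isIso_end_of_isIso_map [F.Full] {X : C} (hX : ∀ f : X ⟶ X, F.map f = 0 → IsNilpotent (End.of f)) (f : X ⟶ X)
    [IsIso (F.map f)] : IsIso f :=
  (isUnit_iff_isIso (End.of f)).1 (isUnit_end_of_isUnit_map hX (End.of f) ((isUnit_iff_isIso _).2 (by
    change IsIso (F.map f); infer_instance)))

/-- **CONSERVATIVITY: a full additive functor with nil kernel at `X` and at `Y` reflects isomorphisms `X ⟶ Y`** — with `F g = (F f)⁻¹`,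
`f ≫ g` and `g ≫ f` are endomorphisms sent to identities, hence isomorphisms by the previous lemma, so `f` is a split mono and a split
epi. («le foncteur quotient `𝒜 → 𝒜∕rad(𝒜)` [est] conservatif, i.e. reflète les isomorphismes»; 2.3.4 f).) [cite: AndreKahn2002Nilpotence,
Prop. 1.4.4 b), Prop. 2.3.4 f), Lemme 1.4.7] -/
theorem isIso_of_isIso_map [F.Full] {X Y : C} (hX : ∀ f : X ⟶ X, F.map f = 0 → IsNilpotent (End.of f))
    (hY : ∀ f : Y ⟶ Y, F.map f = 0 → IsNilpotent (End.of f)) (f : X ⟶ Y) [IsIso (F.map f)] : IsIso f := by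
  obtain ⟨g, hg⟩ := F.map_surjective (inv (F.map f))
  haveI : IsIso (F.map (f ≫ g)) := by rw [F.map_comp, hg]; infer_instance
  haveI : IsIso (F.map (g ≫ f)) := by rw [F.map_comp, hg]; infer_instance
  haveI := isIso_end_of_isIso_map hX (f ≫ g)
  haveI := isIso_end_of_isIso_map hY (g ≫ f)
  haveI : IsSplitMono f := IsSplitMono.mk' ⟨g ≫ inv (f ≫ g), by rw [← Category.assoc, IsIso.hom_inv_id]⟩
  haveI : IsSplitEpi f := IsSplitEpi.mk' ⟨inv (g ≫ f) ≫ g, by rw [Category.assoc, IsIso.inv_hom_id]⟩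
  exact isIso_of_epi_of_isSplitMono f

/-- `f` is an isomorphism iff `F f` is (nil kernel at both ends, `F` full). [cite: AndreKahn2002Nilpotence, Prop. 1.4.4 b)] -/
theorem isIso_iff_isIso_map [F.Full] {X Y : C} (hX : ∀ f : X ⟶ X, F.map f = 0 → IsNilpotent (End.of f))
    (hY : ∀ f : Y ⟶ Y, F.map f = 0 → IsNilpotent (End.of f)) (f : X ⟶ Y) : IsIso f ↔ IsIso (F.map f) :=
  ⟨fun _ => inferInstance, fun _ => isIso_of_isIso_map hX hY f⟩

/-- **Objects with isomorphic images are isomorphic** (`F` full, nil kernel at `X`, `Y`): an isomorphism `F X ≅ F Y` lifts to a morphism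
`X ⟶ Y`, which is an isomorphism by conservativity. [cite: AndreKahn2002Nilpotence, Prop. 1.4.4 b)] [cite: Krause2015KS, Thm. 4.2] -/
theorem nonempty_iso_of_iso_obj [F.Full] {X Y : C} (hX : ∀ f : X ⟶ X, F.map f = 0 → IsNilpotent (End.of f))
    (hY : ∀ f : Y ⟶ Y, F.map f = 0 → IsNilpotent (End.of f)) (i : F.obj X ≅ F.obj Y) : Nonempty (X ≅ Y) := by
  obtain ⟨f, hf⟩ := F.map_surjective i.hom
  haveI : IsIso (F.map f) := by rw [hf]; infer_instance
  haveI := isIso_of_isIso_map hX hY f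
  exact ⟨asIso f⟩

/-- `X ≅ Y ⟺ F X ≅ F Y` (as propositions). [cite: AndreKahn2002Nilpotence, Prop. 1.4.4 b)] -/
theorem nonempty_iso_iff [F.Full] {X Y : C} (hX : ∀ f : X ⟶ X, F.map f = 0 → IsNilpotent (End.of f))
    (hY : ∀ f : Y ⟶ Y, F.map f = 0 → IsNilpotent (End.of f)) : Nonempty (X ≅ Y) ↔ Nonempty (F.obj X ≅ F.obj Y) :=
  ⟨fun ⟨i⟩ => ⟨F.mapIso i⟩, fun ⟨i⟩ => nonempty_iso_of_iso_obj hX hY i⟩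

/-- **`F` reflects retractions** («ce foncteur reflète aussi rétractions et corétractions»): if `F (s ≫ f)` is an isomorphism for some
`s : Y ⟶ X` (nil kernel at `Y`), then `f` is a split epimorphism. [cite: AndreKahn2002Nilpotence, Prop. 1.4.4 b)] -/
theorem isSplitEpi_of_isIso_map_comp [F.Full] {X Y : C} (hY : ∀ f : Y ⟶ Y, F.map f = 0 → IsNilpotent (End.of f)) (f : X ⟶ Y)
    (s : Y ⟶ X) [IsIso (F.map (s ≫ f))] : IsSplitEpi f := by
  haveI := isIso_end_of_isIso_map hY (s ≫ f)
  exact IsSplitEpi.mk' ⟨inv (s ≫ f) ≫ s, by rw [Category.assoc, IsIso.inv_hom_id]⟩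

/-- Dually `F` reflects corétractions: if `F (f ≫ r)` is an isomorphism for some `r : Y ⟶ X` then `f` is a split monomorphism.
[cite: AndreKahn2002Nilpotence, Prop. 1.4.4 b)] -/
theorem isSplitMono_of_isIso_map_comp [F.Full] {X Y : C} (hX : ∀ f : X ⟶ X, F.map f = 0 → IsNilpotent (End.of f)) (f : X ⟶ Y)
    (r : Y ⟶ X) [IsIso (F.map (f ≫ r))] : IsSplitMono f := by
  haveI := isIso_end_of_isIso_map hX (f ≫ r)
  exact IsSplitMono.mk' ⟨r ≫ inv (f ≫ r), by rw [← Category.assoc, IsIso.hom_inv_id]⟩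

/-- If `F f` is a split epimorphism (with any section in `D`) then `f` is a split epimorphism (`F` full, nil kernel at `Y`).
[cite: AndreKahn2002Nilpotence, Prop. 1.4.4 b)] -/
theorem isSplitEpi_of_isSplitEpi_map [F.Full] {X Y : C} (hY : ∀ f : Y ⟶ Y, F.map f = 0 → IsNilpotent (End.of f)) (f : X ⟶ Y)
    [IsSplitEpi (F.map f)] : IsSplitEpi f := by
  obtain ⟨s, hs⟩ := F.map_surjective (section_ (F.map f))
  haveI : IsIso (F.map (s ≫ f)) := by rw [F.map_comp, hs, IsSplitEpi.id]; infer_instance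
  exact isSplitEpi_of_isIso_map_comp hY f s

/-- If `F f` is a split monomorphism then `f` is a split monomorphism (`F` full, nil kernel at `X`). [cite: AndreKahn2002Nilpotence, Prop. 1.4.4 b)] -/
theorem isSplitMono_of_isSplitMono_map [F.Full] {X Y : C} (hX : ∀ f : X ⟶ X, F.map f = 0 → IsNilpotent (End.of f)) (f : X ⟶ Y)
    [IsSplitMono (F.map f)] : IsSplitMono f := by
  obtain ⟨r, hr⟩ := F.map_surjective (retraction (F.map f))
  haveI : IsIso (F.map (f ≫ r)) := by rw [F.map_comp, hr, IsSplitMono.id]; infer_instance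
  exact isSplitMono_of_isIso_map_comp hX f r

end Conservative

/-! ## §3 Endomorphism rings: `End X ↠ End (F X)` with nil kernel -/

section EndRings

variable {F}

omit [Preadditive C] [Preadditive D] [F.Additive] in
/-- `F.mapEnd X : End X → End (F X)` is onto for `F` full. [cite: AndreKahn2002Nilpotence, Lemme 1.4.7 («si `T` est plein»)] -/
theorem mapEnd_surjective [F.Full] (X : C) : Function.Surjective (F.mapEnd X) := fun g => F.map_surjective g

/-- **`End X` is semiperfect when `End (F X)` is** (`F` full, nil kernel at `X`): `F.mapEnd` is a ring surjection with nil kernel, g37-#1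
`isSemiperfectRing_of_surjective_of_nil_ker`. [cite: AndreKahn2002Nilpotence, Lemme 2.3.3, Prop. 2.3.4] [cite: Krause2015KS, Cor. 4.4] -/
theorem isSemiperfectRing_end_of_full_of_nilKernel [F.Full] {X : C} (hX : ∀ f : X ⟶ X, F.map f = 0 → IsNilpotent (End.of f))
    [IsSemiperfectRing (End (F.obj X))] : IsSemiperfectRing (End X) :=
  Literature.RingTheory.Idempotents.isSemiperfectRing_of_surjective_of_nil_ker (RingHom.mk' (F.mapEnd X) fun _ _ => F.map_add)
    (mapEnd_surjective X) fun f hf => hX (End.asHom f) hf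

/-- `End (F X)` left artinian ⟹ `End X` semiperfect (AK 2.3.4 d): artinian endomorphism rings make a linear category semi-primary).
[cite: AndreKahn2002Nilpotence, Prop. 2.3.4 d), Lemme 2.3.3] [cite: Krause2015KS, Cor. 4.4] -/
theorem isSemiperfectRing_end_of_full_of_nilKernel_of_isArtinianRing [F.Full] {X : C}
    (hX : ∀ f : X ⟶ X, F.map f = 0 → IsNilpotent (End.of f)) [IsArtinianRing (End (F.obj X))] : IsSemiperfectRing (End X) :=
  haveI := Literature.RingTheory.Idempotents.isSemiperfectRing_of_isArtinianRing (R := End (F.obj X))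
  isSemiperfectRing_end_of_full_of_nilKernel hX

/-- `D` `Hom`-finite over a field at `F X` (`End (F X)` finite-dimensional) ⟹ `End X` semiperfect. [cite: AndreKahn2002Nilpotence, Prop. 2.3.4 d)]
[cite: Krause2015KS, Cor. 4.4] -/
theorem isSemiperfectRing_end_of_full_of_nilKernel_of_finite [F.Full] (k : Type*) [Field k] [Linear k D] {X : C}
    (hX : ∀ f : X ⟶ X, F.map f = 0 → IsNilpotent (End.of f)) [Module.Finite k (End (F.obj X))] : IsSemiperfectRing (End X) :=
  haveI : IsArtinianRing (End (F.obj X)) := IsArtinianRing.of_finite k (End (F.obj X))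
  isSemiperfectRing_end_of_full_of_nilKernel_of_isArtinianRing hX

/-- **`End X` local ⟺ `End (F X)` local** (`F` full, nil kernel at `X`, `X ≠ 0`): units lift along `End X ↠ End (F X)` (Lam (21.29)(1)
pattern, g37-#1). [cite: AndreKahn2002Nilpotence, Prop. 1.4.4 a), b)] [cite: Lam2001FirstCourse, §21 Cor. (21.29)(1)] -/
theorem isLocalRing_end_iff_of_full_of_nilKernel [F.Full] {X : C} (hX : ∀ f : X ⟶ X, F.map f = 0 → IsNilpotent (End.of f))
    (hX0 : ¬IsZero X) : IsLocalRing (End X) ↔ IsLocalRing (End (F.obj X)) := by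
  haveI : Nontrivial (End (F.obj X)) := nontrivial_end_of_not_isZero fun h => hX0 (isZero_of_isZero_obj hX h)
  exact Literature.RingTheory.Idempotents.isLocalRing_iff_of_ker_le_jacobson (RingHom.mk' (F.mapEnd X) fun _ _ => F.map_add)
    (mapEnd_surjective X) (Literature.RingTheory.Idempotents.ker_le_jacobson_of_forall_isNilpotent _ fun f hf => hX (End.asHom f) hf)

/-- `End (F X)` local ⟹ `End X` local (no non-vanishing hypothesis needed). [cite: AndreKahn2002Nilpotence, Prop. 1.4.4 b)]
[cite: Lam2001FirstCourse, §21 Cor. (21.29)(1)] -/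
theorem isLocalRing_end_of_isLocalRing_end_obj [F.Full] {X : C} (hX : ∀ f : X ⟶ X, F.map f = 0 → IsNilpotent (End.of f))
    [IsLocalRing (End (F.obj X))] : IsLocalRing (End X) :=
  Literature.RingTheory.Idempotents.isLocalRing_of_ker_le_jacobson (RingHom.mk' (F.mapEnd X) fun _ _ => F.map_add)
    (mapEnd_surjective X) (Literature.RingTheory.Idempotents.ker_le_jacobson_of_forall_isNilpotent _ fun f hf => hX (End.asHom f) hf)

end EndRings

/-! ## §4 Indecomposable objects are reflected and preserved -/

section Indecomposable

variable {F} [HasBinaryBiproducts C] [HasBinaryBiproducts D]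

/-- **`F X` indecomposable ⟹ `X` indecomposable** (split idempotents in `D`, nil kernel at `X`; no fullness): an idempotent `p` of `X` maps
to an idempotent of `F X`, which is `0` or `1` (g36-#13); `F p = 0` makes `p` a nilpotent idempotent, i.e. `0`, and `F(1 − p) = 0` makes
`p = 1`. [cite: AndreKahn2002Nilpotence, Lemme 2.3.3, Prop. 2.3.4 b)] [cite: Krause2015KS, Cor. 4.4] -/
theorem indecomposable_of_indecomposable_obj [IsIdempotentComplete D] {X : C} (hX : ∀ f : X ⟶ X, F.map f = 0 → IsNilpotent (End.of f))
    (h : Indecomposable (F.obj X)) : Indecomposable X := by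
  refine indecomposable_of_forall_idempotent (fun h0 => h.1 (F.map_isZero h0)) fun p hp => ?_
  have hFp : F.map p ≫ F.map p = F.map p := by rw [← F.map_comp, hp]
  rcases idempotent_eq_zero_or_id_of_indecomposable h (F.map p) hFp with h0 | h1
  · left
    exact IsIdempotentElem.eq_zero_of_isNilpotent (show IsIdempotentElem (End.of p) from hp) (hX p h0)
  · right
    have hq : IsIdempotentElem (End.of (𝟙 X - p)) := by
      show (𝟙 X - p) ≫ (𝟙 X - p) = 𝟙 X - p
      rw [Preadditive.sub_comp, Preadditive.comp_sub, Preadditive.comp_sub, Category.id_comp, Category.id_comp, Category.comp_id, hp,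
        sub_self, sub_zero]
    have h0 : End.of (𝟙 X - p) = 0 := IsIdempotentElem.eq_zero_of_isNilpotent hq (hX _ (by rw [F.map_sub, F.map_id, h1, sub_self]))
    exact (sub_eq_zero.mp h0).symm

/-- **`X` indecomposable ⟹ `F X` indecomposable** (split idempotents in `C`, `F` full, nil kernel at `X`): an idempotent of `F X` lifts
along the nil-kernel surjection `End X ↠ End (F X)` to an idempotent of `X` (AK Lemme 2.3.3 = Mathlib), which is `0` or `1`; and `F X ≠ 0`
(§1). [cite: AndreKahn2002Nilpotence, Lemme 2.3.3, Prop. 2.3.4 b)] [cite: Krause2015KS, Cor. 4.4] -/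
theorem indecomposable_obj_of_indecomposable [IsIdempotentComplete C] [F.Full] {X : C}
    (hX : ∀ f : X ⟶ X, F.map f = 0 → IsNilpotent (End.of f)) (h : Indecomposable X) : Indecomposable (F.obj X) := by
  refine indecomposable_of_forall_idempotent (fun h0 => h.1 (isZero_of_isZero_obj hX h0)) fun q hq => ?_
  obtain ⟨p, hp, hpq⟩ := exists_isIdempotentElem_eq_of_ker_isNilpotent (RingHom.mk' (F.mapEnd X) fun _ _ => F.map_add)
    (fun f hf => hX (End.asHom f) hf) (End.of q) (mapEnd_surjective X (End.of q)) hq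
  -- `hpq : F.map p = q`
  have hpq' : F.map (End.asHom p) = q := hpq
  rcases idempotent_eq_zero_or_id_of_indecomposable h (End.asHom p) hp with h0 | h1
  · left
    rw [← hpq', h0, F.map_zero]
  · right
    rw [← hpq', h1, F.map_id]

/-- **`X` indecomposable ⟺ `F X` indecomposable** (both categories idempotent complete, `F` full additive with nil kernel at `X`).
[cite: AndreKahn2002Nilpotence, Lemme 2.3.3, Prop. 2.3.4 b), f)] [cite: Krause2015KS, Cor. 4.4] -/
theorem indecomposable_iff_indecomposable_obj [IsIdempotentComplete C] [IsIdempotentComplete D] [F.Full] {X : C}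
    (hX : ∀ f : X ⟶ X, F.map f = 0 → IsNilpotent (End.of f)) : Indecomposable X ↔ Indecomposable (F.obj X) :=
  ⟨indecomposable_obj_of_indecomposable hX, indecomposable_of_indecomposable_obj hX⟩

omit [HasBinaryBiproducts D] in
/-- For `End (F X)` left artinian (`F` full, nil kernel at `X`, split idempotents in `C`): `X` indecomposable ⟺ `End X` local ⟺
`End (F X)` local. [cite: AndreKahn2002Nilpotence, Prop. 2.3.4 d)] [cite: Krause2015KS, Cor. 4.4] [cite: Lam2001FirstCourse, §21 Cor. (21.29)(1)] -/
theorem indecomposable_iff_isLocalRing_end_of_full_of_nilKernel [IsIdempotentComplete C] [F.Full] {X : C}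
    (hX : ∀ f : X ⟶ X, F.map f = 0 → IsNilpotent (End.of f)) [IsArtinianRing (End (F.obj X))] :
    Indecomposable X ↔ IsLocalRing (End X) :=
  haveI := isSemiperfectRing_end_of_full_of_nilKernel_of_isArtinianRing hX
  indecomposable_iff_isLocalRing_end_of_isSemiperfectRing

end Indecomposable

/-! ## §5 Transport of Krull–Remak–Schmidt decompositions -/

section Transport

variable {F} [HasFiniteBiproducts C]

/-- An additive functor maps a biproduct decomposition `X ≅ ⨁ Xs` to `F X ≅ ⨁ F Xs`. [cite: Krause2015KS, §4] -/
theorem nonempty_iso_biproduct_obj {X : C} {ι : Type} [Fintype ι] {Xs : ι → C} (i : X ≅ ⨁ Xs) :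
    Nonempty (F.obj X ≅ ⨁ (F.obj ∘ Xs)) :=
  ⟨F.mapIso i ≪≫ F.mapBiproduct Xs⟩

/-- **`F` carries decompositions of `X` into indecomposables to decompositions of `F X` into indecomposables** (`F` full, nil kernel at
`X` — inherited by the summands (§1) — split idempotents in `C`). [cite: AndreKahn2002Nilpotence, Prop. 2.3.4 b), c)] [cite: Krause2015KS, §4] -/
theorem indecomposable_obj_of_iso_biproduct [HasBinaryBiproducts C] [HasBinaryBiproducts D] [IsIdempotentComplete C] [F.Full] {X : C}
    (hX : ∀ f : X ⟶ X, F.map f = 0 → IsNilpotent (End.of f)) {ι : Type} [Fintype ι] {Xs : ι → C} (i : X ≅ ⨁ Xs)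
    (h : ∀ j, Indecomposable (Xs j)) (j : ι) : Indecomposable (F.obj (Xs j)) :=
  indecomposable_obj_of_indecomposable (nilKernel_of_iso_biproduct i hX j) (h j)

/-- **EXISTENCE AND TRANSPORT: if `End (F X)` is left artinian (`F` full additive, nil kernel at `X`, split idempotents in `C`), then
`X ≅ ⨁ⱼ Yⱼ` with the `Yⱼ` indecomposable with local endomorphism rings, and `F X ≅ ⨁ⱼ F Yⱼ` with the `F Yⱼ` indecomposable with local
endomorphism rings.** [cite: Krause2015KS, Cor. 4.4, Thm. 4.2] [cite: AndreKahn2002Nilpotence, Prop. 2.3.4 b), d)] -/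
theorem exists_iso_biproduct_indecomposable_and_obj [HasBinaryBiproducts C] [HasBinaryBiproducts D] [IsIdempotentComplete C] [F.Full]
    (X : C)
    (hX : ∀ f : X ⟶ X, F.map f = 0 → IsNilpotent (End.of f)) [IsArtinianRing (End (F.obj X))] :
    ∃ (n : ℕ) (Y : Fin n → C), Nonempty (X ≅ ⨁ Y) ∧ (∀ j, Indecomposable (Y j) ∧ IsLocalRing (End (Y j))) ∧
      Nonempty (F.obj X ≅ ⨁ (F.obj ∘ Y)) ∧ ∀ j, Indecomposable (F.obj (Y j)) ∧ IsLocalRing (End (F.obj (Y j))) := by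
  haveI := isSemiperfectRing_end_of_full_of_nilKernel_of_isArtinianRing hX
  obtain ⟨n, Y, ⟨i⟩, hY⟩ := exists_iso_biproduct_indecomposable_of_isSemiperfectRing X
  refine ⟨n, Y, ⟨i⟩, hY, nonempty_iso_biproduct_obj i, fun j => ⟨indecomposable_obj_of_iso_biproduct hX i (fun j => (hY j).1) j, ?_⟩⟩
  haveI := (hY j).2
  haveI : Nontrivial (End (F.obj (Y j))) :=
    nontrivial_end_of_not_isZero fun h => (hY j).1.1 (isZero_of_isZero_obj (nilKernel_of_iso_biproduct i hX j) h)
  exact Literature.RingTheory.Idempotents.isLocalRing_of_surjective (RingHom.mk' (F.mapEnd (Y j)) fun _ _ => F.map_add)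
    (mapEnd_surjective (Y j))

/-- **KRULL–REMAK–SCHMIDT FOR `X` FROM `Hom`-FINITENESS DOWNSTAIRS** (`F` full additive with nil kernel at `X`, split idempotents in `C`,
`End (F X)` left artinian): existence and uniqueness of decompositions of `X` into indecomposables (g37-#2 for the semiperfect ring `End X`).
[cite: Krause2015KS, Cor. 4.4, Thm. 4.2] [cite: AndreKahn2002Nilpotence, Prop. 2.3.4 d)] -/
theorem krullRemakSchmidt_of_full_of_nilKernel [HasBinaryBiproducts C] [IsIdempotentComplete C] [F.Full] (X : C)
    (hX : ∀ f : X ⟶ X, F.map f = 0 → IsNilpotent (End.of f)) [IsArtinianRing (End (F.obj X))] :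
    (∃ (n : ℕ) (Y : Fin n → C), Nonempty (X ≅ ⨁ Y) ∧ ∀ j, Indecomposable (Y j) ∧ IsLocalRing (End (Y j))) ∧
      ∀ {r s : ℕ} {Xs : Fin r → C} {Ys : Fin s → C}, Nonempty (X ≅ ⨁ Xs) → Nonempty (X ≅ ⨁ Ys) →
        (∀ j, Indecomposable (Xs j)) → (∀ k, Indecomposable (Ys k)) →
          r = s ∧ ∃ σ : Fin r ≃ Fin s, ∀ j, Nonempty (Xs j ≅ Ys (σ j)) :=
  haveI := isSemiperfectRing_end_of_full_of_nilKernel_of_isArtinianRing hX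
  krullRemakSchmidt_of_isSemiperfectRing X

/-- The same with `End (F X)` finite-dimensional over a field `k` (`D` `k`-linear, `Hom`-finite at `F X`). [cite: Krause2015KS, Cor. 4.4, Thm. 4.2]
[cite: AndreKahn2002Nilpotence, Prop. 2.3.4 d)] -/
theorem krullRemakSchmidt_of_full_of_nilKernel_of_finite [HasBinaryBiproducts C] [IsIdempotentComplete C] [F.Full] (k : Type*) [Field k] [Linear k D] (X : C)
    (hX : ∀ f : X ⟶ X, F.map f = 0 → IsNilpotent (End.of f)) [Module.Finite k (End (F.obj X))] :
    (∃ (n : ℕ) (Y : Fin n → C), Nonempty (X ≅ ⨁ Y) ∧ ∀ j, Indecomposable (Y j) ∧ IsLocalRing (End (Y j))) ∧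
      ∀ {r s : ℕ} {Xs : Fin r → C} {Ys : Fin s → C}, Nonempty (X ≅ ⨁ Xs) → Nonempty (X ≅ ⨁ Ys) →
        (∀ j, Indecomposable (Xs j)) → (∀ k, Indecomposable (Ys k)) →
          r = s ∧ ∃ σ : Fin r ≃ Fin s, ∀ j, Nonempty (Xs j ≅ Ys (σ j)) :=
  haveI : IsArtinianRing (End (F.obj X)) := IsArtinianRing.of_finite k (End (F.obj X))
  krullRemakSchmidt_of_full_of_nilKernel X hX

/-- **Decompositions are detected downstairs**: two decompositions of `X` into indecomposables (`F` full additive, nil kernel at `X`, split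
idempotents in `C` and `D`, `End (F X)` left artinian) are matched, `Xⱼ ≅ Y_{σ j}`, iff their images are: `F Xⱼ ≅ F Y_{σ j}` (summands
inherit the nil kernel, §2 lifts the isomorphisms). [cite: Krause2015KS, Thm. 4.2] [cite: AndreKahn2002Nilpotence, Prop. 1.4.4 b)] -/
theorem nonempty_iso_summand_iff [F.Full] {X : C} (hX : ∀ f : X ⟶ X, F.map f = 0 → IsNilpotent (End.of f)) {ι κ : Type}
    [Fintype ι] [Fintype κ] {Xs : ι → C} {Ys : κ → C} (i₁ : X ≅ ⨁ Xs) (i₂ : X ≅ ⨁ Ys) (j : ι) (k : κ) :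
    Nonempty (Xs j ≅ Ys k) ↔ Nonempty (F.obj (Xs j) ≅ F.obj (Ys k)) :=
  nonempty_iso_iff (nilKernel_of_iso_biproduct i₁ hX j) (nilKernel_of_iso_biproduct i₂ hX k)

end Transport

end Literature.CategoryTheory.KrullSchmidt
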